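import Summits.ValiantsHypothesis.ValiantsHypothesis.Theorems.KPlusLogSqLawTropicalBTransferLaw

/-!
# Route «KPlusLogSqLaw», crux `TropicalB` (stmt-ValiantsHypothesis-19771) — marked-edge binary counters are ENTANGLED IN EVERY CONTEXT
# and step by SINGLE EXCHANGES (the transfer and unit-step laws instantiated in the marked-edge sector)

HONEST FRAMING.  Helper file toward the registered stubs `stub_tropThin` / `stub_tropFat` of `Cruxes/TropicalB/Lines/birth.lean` (crux
`Summit.ValiantsHypothesis.ValiantsHypothesis.Theses.KPlusLogSqLaw.TropicalB`, item stmt-ValiantsHypothesis-19771, route KPlusLogSqLaw; cell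
`pub-symmetroid`, seat val-sym-trop-p5 g17, refuter-adjacent lane, 2026-08-28; `--supports … --as helper`).  STRUCTURE laws for the radix-2 rung
(val-sym-trop-p4 g14/g15's MARKED-EDGE sector, `…TropicalBMarkedEdgeCounter` / `…MarkedEdgeFourThree`): in a design of format `(m, K+1)` whose class
`l+1` lives exactly on the diagonal cell `(l,l)` (`l < K`, exponent `2^l`) and whose class `0` (exponent `0`) lives exactly on the other cells — the
sector condition verbatim as in `markedEdge_five_three_counter` — consider ANY family of dominant terms `p k` indexed by `k : Fin (N+1)` at strictly
increasing slopes `θ`, with the BINARY property «term `k` uses class `l+1` iff bit `l` of `k` is set».  Then (no bound on `m`, `K`, `N`):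
* `dval` — column bookkeeping: in column `i` the term `p k` carries exponent `2^i` if `i < K` and bit `i` of `k` is set, and `0` otherwise; hence
  `slope_sub_of_flip`: two indices whose bits agree off one position `u` have slopes differing by exactly `2^u`.
* **`sameCycle_of_binary` (ENTANGLEMENT IN EVERY CONTEXT)**: for indices `a, b, c, e` with `b ≤ c` whose bits say «`b = a` with bit `u` switched
  on, `c = a` with bit `w` switched on, `e = c` with bit `u` switched on» (`u ≠ w` bit columns), the columns `u` and `w` lie on ONE cycle of the quotient
  permutation `(σ_b)⁻¹ σ_c` — the marked loop of `u` (used by `p b`) and the marked loop of `w` (used by `p c`) sit on a common alternating cycle.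
  (`TransferLaw.sameCycle_of_columns` with the bookkeeping above; val-sym-trop-p4 g14's paper rule «E0», for every context, kernel.)
* **`sameCycle_of_succ` (SINGLE EXCHANGE PER STEP)**: if the bits of `k'` are those of `k` with bit `j` switched on and the bits below `j` switched
  off (a binary increment; in particular the slopes differ by `1` when bits `0..j-1` of `k` are set — stated here through the slope hypothesis
  `slope (p k') ≤ slope (p k) + 1`), then all columns where `p k`, `p k'` differ lie on one cycle of `(σ_k)⁻¹ σ_{k'}` (`UnitStep.sameCycle`).
READING: every full binary counter (m_min(2)=3, m_min(3)=5, (7,4) open) satisfies these in all `2^K` contexts; they are the combinatorial filters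
behind the seat's architecture census (memo HOME/val-sym-trop-p5/g17/COUNTER-MECHANISMS-g17.md).  Nothing here bounds `TropicalB` in its window or bears
on `WeakLifting`, DoorA26 / DoorA34, `MatrixDescartes` (stmt-ValiantsHypothesis-18050) or VP ≠ VNP.  [this seat; exchange arguments are folklore]
-/

set_option linter.dupNamespace false
set_option autoImplicit false

namespace Summit.ValiantsHypothesis.ValiantsHypothesis.Theorems.KPlusLogSqLaw

open Summit.ValiantsHypothesis.ValiantsHypothesis.Theorems.MatrixDescartes.Negative
open Summit.ValiantsHypothesis.ValiantsHypothesis.Theorems.LacunarySymmetroidMatrixDescartes (TropicalCensus.slope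
  TropicalCensus.present_of_termSign_ne_zero)
open scoped BigOperators

namespace MarkedEdgeEntangled

variable {m K N : ℕ}

/-- **Column bookkeeping in the marked-edge sector.**  If the term `p` is present, the sector condition holds, and «`p` uses class `l+1` iff
bit `l` of `k` is set» for all `l < K`, then in column `i` the term carries exponent `2^i` when `i < K` and bit `i` of `k` is set, and `0`
otherwise. -/
theorem dval (d : Fin (K + 1) → ℕ) (ε : Fin m → Fin m → Fin (K + 1) → ℤ)
    (hd : ∀ l : Fin (K + 1), d l = if (l : ℕ) = 0 then 0 else 2 ^ ((l : ℕ) - 1))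
    (hsec : ∀ (i j : Fin m) (l : Fin (K + 1)), ε i j l ≠ 0 ↔
      ((l = 0 ∧ ¬ (i = j ∧ (i : ℕ) < K)) ∨ (i = j ∧ (i : ℕ) < K ∧ (l : ℕ) = (i : ℕ) + 1)))
    (p : Equiv.Perm (Fin m) × (Fin m → Fin (K + 1))) (hp : termSign ε p ≠ 0) (k : ℕ)
    (hbin : ∀ l : ℕ, l < K → ((∃ i : Fin m, ((p.2 i : Fin (K + 1)) : ℕ) = l + 1) ↔ Nat.testBit k l = true))
    (i : Fin m) :
    (d (p.2 i) : ℤ) = if (i : ℕ) < K ∧ Nat.testBit k i = true then (2 : ℤ) ^ (i : ℕ) else 0 := by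
  have pres := TropicalCensus.present_of_termSign_ne_zero ε p hp i
  rcases (hsec (p.1 i) i (p.2 i)).mp pres with ⟨hl0, hnot⟩ | ⟨hrow, hiK, hl⟩
  · -- class 0 in column i: then bit i is NOT set (else class i+1 would sit in column i)
    have hdi : d (p.2 i) = 0 := by rw [hd]; simp [hl0]
    rw [hdi]
    by_cases hc : (i : ℕ) < K ∧ Nat.testBit k i = true
    · exfalso
      obtain ⟨j, hj⟩ := (hbin i hc.1).mpr hc.2
      have presj := TropicalCensus.present_of_termSign_ne_zero ε p hp j
      rcases (hsec (p.1 j) j (p.2 j)).mp presj with ⟨hj0, _⟩ | ⟨_, _, hjl⟩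
      · rw [hj0] at hj; simp at hj
      · rw [hjl] at hj
        have hji : j = i := Fin.ext (by omega)
        rw [hji] at hjl
        rw [hl0] at hjl
        simp at hjl
    · simp [hc]
  · -- class i+1 in column i: bit i is set
    rw [hrow] at hiK hl
    have hset : Nat.testBit k i = true := (hbin i hiK).mp ⟨i, hl⟩
    have hdi : d (p.2 i) = 2 ^ (i : ℕ) := by
      rw [hd]
      have hne : ((p.2 i : Fin (K + 1)) : ℕ) ≠ 0 := by rw [hl]; omega
      rw [if_neg hne, hl]
      simp
    rw [hdi, if_pos ⟨hiK, hset⟩]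
    push_cast
    rfl

/-- **Slope bookkeeping**: if the bits of `kb` are those of `ka` with bit `u` (`u < K` a column) switched on, then
`slope (p_b) − slope (p_a) = 2^u`. -/
theorem slope_sub_of_flip (d : Fin (K + 1) → ℕ) (ε : Fin m → Fin m → Fin (K + 1) → ℤ)
    (hd : ∀ l : Fin (K + 1), d l = if (l : ℕ) = 0 then 0 else 2 ^ ((l : ℕ) - 1))
    (hsec : ∀ (i j : Fin m) (l : Fin (K + 1)), ε i j l ≠ 0 ↔
      ((l = 0 ∧ ¬ (i = j ∧ (i : ℕ) < K)) ∨ (i = j ∧ (i : ℕ) < K ∧ (l : ℕ) = (i : ℕ) + 1)))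
    (pa pb : Equiv.Perm (Fin m) × (Fin m → Fin (K + 1))) (hpa : termSign ε pa ≠ 0) (hpb : termSign ε pb ≠ 0)
    (ka kb : ℕ)
    (hbina : ∀ l : ℕ, l < K → ((∃ i : Fin m, ((pa.2 i : Fin (K + 1)) : ℕ) = l + 1) ↔ Nat.testBit ka l = true))
    (hbinb : ∀ l : ℕ, l < K → ((∃ i : Fin m, ((pb.2 i : Fin (K + 1)) : ℕ) = l + 1) ↔ Nat.testBit kb l = true))
    (u : Fin m) (huK : (u : ℕ) < K) (hoff : ∀ l : ℕ, l ≠ (u : ℕ) → Nat.testBit kb l = Nat.testBit ka l)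
    (hbu : Nat.testBit kb u = true) (hau : Nat.testBit ka u = false) :
    TropicalCensus.slope d pb - TropicalCensus.slope d pa = (2 : ℤ) ^ (u : ℕ) := by
  unfold TropicalCensus.slope
  rw [← Finset.sum_sub_distrib]
  rw [Finset.sum_eq_single u]
  · rw [dval d ε hd hsec pb hpb kb hbinb u, dval d ε hd hsec pa hpa ka hbina u]
    simp [huK, hbu, hau]
  · intro i _ hiu
    rw [dval d ε hd hsec pb hpb kb hbinb i, dval d ε hd hsec pa hpa ka hbina i]
    have hne : (i : ℕ) ≠ (u : ℕ) := fun h => hiu (Fin.ext h)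
    rw [hoff i hne]
    simp
  · intro hu; exact absurd (Finset.mem_univ u) hu

/-- **ENTANGLEMENT IN EVERY CONTEXT (marked-edge sector).**  Dominant terms `p k` (`k : Fin (N+1)`) at strictly increasing slopes `θ`, sector
condition and binary property as in `…MarkedEdgeCounter`.  If the bits of `b` are those of `a` with bit `u` switched on, the bits of `c` agree with those of `a` off position `w`, and the bits of
`e` are those of `c` with bit `u` switched on (`u ≠ w` columns, `u < K`, `b ≤ c` — e.g. `a, b, c, e = w₀, w₀+2^u, w₀+2^w, w₀+2^u+2^w` for a
context `w₀`), then the columns `u` and `w` lie on one cycle of `(σ_b)⁻¹ σ_c`: the optimal covers of the two one-bit refinements of any context are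
entangled (the marked loop of `u` in `p b` and the cell of `p c` in column `u` start a common alternating cycle through column `w`). -/
theorem sameCycle_of_binary (d : Fin (K + 1) → ℕ) (v ε : Fin m → Fin m → Fin (K + 1) → ℤ)
    (hd : ∀ l : Fin (K + 1), d l = if (l : ℕ) = 0 then 0 else 2 ^ ((l : ℕ) - 1))
    (hsec : ∀ (i j : Fin m) (l : Fin (K + 1)), ε i j l ≠ 0 ↔
      ((l = 0 ∧ ¬ (i = j ∧ (i : ℕ) < K)) ∨ (i = j ∧ (i : ℕ) < K ∧ (l : ℕ) = (i : ℕ) + 1)))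
    (θ : Fin (N + 1) → ℤ) (hθ : StrictMono θ) (p : Fin (N + 1) → Equiv.Perm (Fin m) × (Fin m → Fin (K + 1)))
    (hdom : ∀ k, IsDominant d v ε (θ k) (p k))
    (hbin : ∀ (k : Fin (N + 1)) (l : ℕ), l < K →
      ((∃ i : Fin m, (((p k).2 i : Fin (K + 1)) : ℕ) = l + 1) ↔ Nat.testBit (k : ℕ) l = true))
    (a b c e : Fin (N + 1)) (hbc : b ≤ c) (u w : Fin m) (huK : (u : ℕ) < K) (huw : u ≠ w)
    (hb : ∀ l : ℕ, l ≠ (u : ℕ) → Nat.testBit (b : ℕ) l = Nat.testBit (a : ℕ) l)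
    (hbu : Nat.testBit (b : ℕ) u = true) (hau : Nat.testBit (a : ℕ) u = false)
    (hc : ∀ l : ℕ, l ≠ (w : ℕ) → Nat.testBit (c : ℕ) l = Nat.testBit (a : ℕ) l)
    (he : ∀ l : ℕ, l ≠ (u : ℕ) → Nat.testBit (e : ℕ) l = Nat.testBit (c : ℕ) l)
    (heu : Nat.testBit (e : ℕ) u = true) :
    ((p b).1⁻¹ * (p c).1).SameCycle u w := by
  have hcu : Nat.testBit (c : ℕ) u = false := by
    rw [hc u (fun h => huw (Fin.ext h))]; exact hau
  have sba := slope_sub_of_flip d ε hd hsec (p a) (p b) (hdom a).1 (hdom b).1 a b (hbin a) (hbin b) u huK hb hbu hau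
  have sec := slope_sub_of_flip d ε hd hsec (p c) (p e) (hdom c).1 (hdom e).1 c e (hbin c) (hbin e) u huK he heu hcu
  refine TransferLaw.sameCycle_of_columns d v ε (hθ.monotone hbc) (hdom a) (hdom b) (hdom c) (hdom e) ?_
    (u := u) (w := w) ?_ ?_ ?_
  · have : (0 : ℤ) < (2 : ℤ) ^ (u : ℕ) := by positivity
    linarith
  · intro i hiu hiw
    have h1 := dval d ε hd hsec (p b) (hdom b).1 b (hbin b) i
    have h2 := dval d ε hd hsec (p c) (hdom c).1 c (hbin c) i
    have hiu' : (i : ℕ) ≠ (u : ℕ) := fun h => hiu (Fin.ext h)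
    have hiw' : (i : ℕ) ≠ (w : ℕ) := fun h => hiw (Fin.ext h)
    rw [hb i hiu'] at h1
    rw [hc i hiw'] at h2
    exact_mod_cast h1.trans h2.symm
  · rw [dval d ε hd hsec (p b) (hdom b).1 b (hbin b) u, dval d ε hd hsec (p c) (hdom c).1 c (hbin c) u, sba]
    simp [huK, hbu, hcu]
  · rw [sba, sec]

/-- **SINGLE EXCHANGE PER STEP (marked-edge reading of the unit-step law).**  For two chain terms at `θ k < θ k'` whose slopes differ by at
most one (e.g. consecutive terms of a full binary counter), all columns where they differ lie on one cycle of the quotient permutation. -/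
theorem sameCycle_of_succ (d : Fin (K + 1) → ℕ) (v ε : Fin m → Fin m → Fin (K + 1) → ℤ)
    (θ : Fin (N + 1) → ℤ) (hθ : StrictMono θ) (p : Fin (N + 1) → Equiv.Perm (Fin m) × (Fin m → Fin (K + 1)))
    (hdom : ∀ k, IsDominant d v ε (θ k) (p k)) (k k' : Fin (N + 1)) (hkk : k < k')
    (hgap : TropicalCensus.slope d (p k') ≤ TropicalCensus.slope d (p k) + 1) {i i' : Fin m}
    (hi : (p k).1 i ≠ (p k').1 i ∨ (p k).2 i ≠ (p k').2 i) (hi' : (p k).1 i' ≠ (p k').1 i' ∨ (p k).2 i' ≠ (p k').2 i') :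
    ((p k).1⁻¹ * (p k').1).SameCycle i i' := by
  have h1 : IsDominant d v ε (θ k) ((p k).1, (p k).2) := hdom k
  have h2 : IsDominant d v ε (θ k') ((p k').1, (p k').2) := hdom k'
  exact UnitStep.sameCycle d v ε (hθ hkk) h1 h2 hgap hi hi'

end MarkedEdgeEntangled

end Summit.ValiantsHypothesis.ValiantsHypothesis.Theorems.KPlusLogSqLaw
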